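import Summits.CriticalPhenomena.SAWScalingLimit.Theorems.SAWDevelopingMapPotentialExistsTopology
import HarnessLib

/-!
# Route `SAWDevelopingMap`, item `PotentialExists` (stmt-CriticalPhenomena-8299) — extension step

Helper file 2/4 for the potential lemma `F = dH` of the route `SAWDevelopingMap`
(`Summits/CriticalPhenomena/SAWScalingLimit/Theses/SAWDevelopingMap.lean`, decl `PotentialExists`):
the induction step of the discrete Poincaré lemma (`exists_potential`, sibling file
`SAWDevelopingMapPotentialExistsPoincare.lean`).

Setting.  `Λ` is a finite set of faces of the triangular lattice `𝕋` (= vertices of `ℍ`) with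
connected complement (`hexDomainSimplyConnected Λ`); `g f f' ∈ ℂ` is a "discrete 1-form" on the
darts `f → f'` of `ℍ` (the increment prescribed along the dual `𝕋`-edge, traversed with `f` on
its left), antisymmetric on `Λ` and closed on the faces of `Λ`; a potential is `H : Site 2 → ℂ`
on the vertices of `𝕋` with the prescribed increments around every face of `Λ`, written in
coordinates (`e₀ = Pi.single 0 1`, `e₁ = Pi.single 1 1`): the up face `(x, 0)` has
counter-clockwise vertices `x, x + e₀, x + e₁`, the faces across these edges being
`(x - e₁, 1)`, `(x, 1)`, `(x - e₀, 1)`; the down face `(x, 1)` has counter-clockwise vertices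
`x + e₀, x + e₀ + e₁, x + e₁`, the faces across being `(x + e₀, 0)`, `(x + e₁, 0)`, `(x, 0)`.

* `simplyConnected_erase`: removing a face adjacent to the complement keeps the complement
  connected;
* `extend_three`: a potential `H'` is corrected by constants on the classes of a symmetric
  relation `R` so as to acquire prescribed increments around one triangle, provided the
  increments of `H'` between `R`-joined vertices of the triangle are already the prescribed ones;
* `step_up`: the induction step at a topmost up face `v = (x, 0)` of `Λ` (`(x, 1) ∉ Λ`): the
  compatibility required by `extend_three` between two vertices of `v` joined through faces of
  `Λ ∖ {v}` is read off the face of `Λ` across that edge, or forced by closedness at `v`, or the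
  joining is excluded by `not_reflTransGen_of_two_outer_nbrs`
  (`SAWDevelopingMapPotentialExistsTopology.lean`: `v` has two outer neighbours).

No new definitions; every declaration is proved.
-/

noncomputable section

namespace Summit.CriticalPhenomena.SAWScalingLimit.Theorems.PotentialExists

open Finset Literature.Probability.LatticeModels Literature.Probability.RandomPlanarGeometry.SAW

/-! ### Removing a boundary face keeps the complement connected -/

/-- If the complement of `Λ` is connected in `ℍ` and `v` is adjacent to some `u ∉ Λ`, then the
complement of `Λ ∖ {v}` is connected. [folklore] -/
theorem simplyConnected_erase {Λ : Finset HexVertex} (hΛ : hexDomainSimplyConnected Λ)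
    {v u : HexVertex} (hu : u ∉ Λ) (hvu : hexGraph.Adj v u) :
    hexDomainSimplyConnected (Λ.erase v) := by
  unfold hexDomainSimplyConnected at hΛ ⊢
  have hset : ((↑(Λ.erase v) : Set HexVertex)ᶜ) = (↑Λ : Set HexVertex)ᶜ ∪ {v} := by
    ext f
    simp only [Finset.coe_erase, Set.mem_compl_iff, Set.mem_sdiff, Finset.mem_coe,
      Set.mem_singleton_iff, Set.mem_union]
    tauto
  rw [hset]
  have ht : (hexGraph.induce ({v} : Set HexVertex)).Preconnected := by
    rw [SimpleGraph.induce_singleton_eq_top]; exact SimpleGraph.preconnected_top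
  exact (SimpleGraph.connected_induce_union hΛ ht (by simpa using hu) rfl hvu.symm).preconnected

/-! ### Correcting a potential by constants on the classes of a chain relation -/

/-- **Extension across one triangle.** Let `R` be a symmetric relation on the vertices of `𝕋` and
`H'` a function.  Given three vertices `q₀, q₁, q₂` and prescribed increments `γ₀₁, γ₁₂, γ₂₀`
summing to zero such that, whenever two of the `qᵢ` are joined by an `R`-chain, `H'` already has
the prescribed increment between them, there is a function `H` with the same increments as `H'`
along `R` and the prescribed increments around the triangle (add suitable constants on the chain
classes of `q₁` and `q₂`). [folklore] -/
theorem extend_three (R : Site 2 → Site 2 → Prop) (hR : ∀ p q, R p q → R q p)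
    (H' : Site 2 → ℂ) (q₀ q₁ q₂ : Site 2) (γ₀₁ γ₁₂ γ₂₀ : ℂ) (hγ : γ₀₁ + γ₁₂ + γ₂₀ = 0)
    (h₀₁ : Relation.ReflTransGen R q₀ q₁ → H' q₁ - H' q₀ = γ₀₁)
    (h₁₂ : Relation.ReflTransGen R q₁ q₂ → H' q₂ - H' q₁ = γ₁₂)
    (h₂₀ : Relation.ReflTransGen R q₂ q₀ → H' q₀ - H' q₂ = γ₂₀) :
    ∃ H : Site 2 → ℂ, (∀ p q, R p q → H q - H p = H' q - H' p) ∧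
      H q₁ - H q₀ = γ₀₁ ∧ H q₂ - H q₁ = γ₁₂ ∧ H q₀ - H q₂ = γ₂₀ := by
  classical
  have hsymm : ∀ p q, Relation.ReflTransGen R p q → Relation.ReflTransGen R q p := by
    intro p q h
    induction h with
    | refl => exact Relation.ReflTransGen.refl
    | tail _ hbc ih => exact Relation.ReflTransGen.head (hR _ _ hbc) ih
  set c₁ : ℂ := γ₀₁ - (H' q₁ - H' q₀) with hc₁
  set c₂ : ℂ := (γ₀₁ + γ₁₂) - (H' q₂ - H' q₀) with hc₂
  set δ : Site 2 → ℂ := fun p =>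
    if Relation.ReflTransGen R q₀ p then 0
    else if Relation.ReflTransGen R q₁ p then c₁
    else if Relation.ReflTransGen R q₂ p then c₂ else 0 with hδ
  have hrefl : ∀ q : Site 2, Relation.ReflTransGen R q q := fun q => Relation.ReflTransGen.refl
  have hδ₀ : δ q₀ = 0 := by simp only [hδ, if_pos (hrefl q₀)]
  have hδ₁ : H' q₁ + δ q₁ - H' q₀ = γ₀₁ := by
    by_cases h : Relation.ReflTransGen R q₀ q₁
    · have e := h₀₁ h
      simp only [hδ, if_pos h]
      linear_combination e
    · simp only [hδ, if_neg h, if_pos (hrefl _), hc₁]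
      ring
  have hδ₂ : H' q₂ + δ q₂ - H' q₀ = γ₀₁ + γ₁₂ := by
    by_cases h : Relation.ReflTransGen R q₀ q₂
    · have e := h₂₀ (hsymm _ _ h)
      simp only [hδ, if_pos h]
      linear_combination -e - hγ
    · by_cases h' : Relation.ReflTransGen R q₁ q₂
      · have e := h₁₂ h'
        have h01 : ¬ Relation.ReflTransGen R q₀ q₁ := fun h01 => h (h01.trans h')
        have e1 : H' q₁ + δ q₁ - H' q₀ = γ₀₁ := hδ₁
        simp only [hδ, if_neg h01, if_pos (hrefl _)] at e1
        simp only [hδ, if_neg h, if_pos h']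
        linear_combination e + e1
      · simp only [hδ, if_neg h, if_neg h', if_pos (hrefl _), hc₂]
        ring
  refine ⟨fun p => H' p + δ p, ?_, ?_, ?_, ?_⟩
  · intro p q hpq
    have e : δ p = δ q := by
      have e0 : Relation.ReflTransGen R q₀ p ↔ Relation.ReflTransGen R q₀ q :=
        ⟨fun h => h.tail hpq, fun h => h.tail (hR _ _ hpq)⟩
      have e1 : Relation.ReflTransGen R q₁ p ↔ Relation.ReflTransGen R q₁ q :=
        ⟨fun h => h.tail hpq, fun h => h.tail (hR _ _ hpq)⟩
      have e2 : Relation.ReflTransGen R q₂ p ↔ Relation.ReflTransGen R q₂ q :=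
        ⟨fun h => h.tail hpq, fun h => h.tail (hR _ _ hpq)⟩
      simp only [hδ, e0, e1, e2]
    change H' q + δ q - (H' p + δ p) = H' q - H' p
    rw [e]; ring
  · change H' q₁ + δ q₁ - (H' q₀ + δ q₀) = γ₀₁
    simp only [hδ₀]; linear_combination hδ₁
  · change H' q₂ + δ q₂ - (H' q₁ + δ q₁) = γ₁₂
    linear_combination hδ₂ - hδ₁
  · change H' q₀ + δ q₀ - (H' q₂ + δ q₂) = γ₂₀
    simp only [hδ₀]; linear_combination -hδ₂ - hγ

/-! ### The induction step: adding back the topmost face -/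

/-- **Induction step, up face.** If `(x, 0) ∈ Λ`, the face `(x, 1)` (to its upper right) is not in
`Λ`, the complement of `Λ` is connected, `g` is antisymmetric and closed on `Λ`, and `H'` is a
potential for `g` on `Λ ∖ {(x, 0)}`, then there is a potential for `g` on `Λ`. [folklore] -/
theorem step_up {Λ : Finset HexVertex} (hΛ : hexDomainSimplyConnected Λ)
    {g : HexVertex → HexVertex → ℂ}
    (hanti : ∀ v ∈ Λ, ∀ w ∈ Λ, hexGraph.Adj v w → g w v = -g v w)
    (hcl0 : ∀ x : Site 2, (x, (0 : Fin 2)) ∈ Λ →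
      g (x, 0) (x - Pi.single 1 1, 1) + g (x, 0) (x, 1) + g (x, 0) (x - Pi.single 0 1, 1) = 0)
    {x : Site 2} (hv : (x, (0 : Fin 2)) ∈ Λ) (hu : (x, (1 : Fin 2)) ∉ Λ) {H' : Site 2 → ℂ}
    (hH' : (∀ y : Site 2, (y, (0 : Fin 2)) ∈ Λ.erase (x, 0) →
        H' (y + Pi.single 0 1) - H' y = g (y, 0) (y - Pi.single 1 1, 1) ∧
        H' (y + Pi.single 1 1) - H' (y + Pi.single 0 1) = g (y, 0) (y, 1) ∧
        H' y - H' (y + Pi.single 1 1) = g (y, 0) (y - Pi.single 0 1, 1)) ∧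
      (∀ y : Site 2, (y, (1 : Fin 2)) ∈ Λ.erase (x, 0) →
        H' (y + Pi.single 0 1 + Pi.single 1 1) - H' (y + Pi.single 0 1) =
            g (y, 1) (y + Pi.single 0 1, 0) ∧
        H' (y + Pi.single 1 1) - H' (y + Pi.single 0 1 + Pi.single 1 1) =
            g (y, 1) (y + Pi.single 1 1, 0) ∧
        H' (y + Pi.single 0 1) - H' (y + Pi.single 1 1) = g (y, 1) (y, 0))) :
    ∃ H : Site 2 → ℂ, (∀ y : Site 2, (y, (0 : Fin 2)) ∈ Λ →
        H (y + Pi.single 0 1) - H y = g (y, 0) (y - Pi.single 1 1, 1) ∧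
        H (y + Pi.single 1 1) - H (y + Pi.single 0 1) = g (y, 0) (y, 1) ∧
        H y - H (y + Pi.single 1 1) = g (y, 0) (y - Pi.single 0 1, 1)) ∧
      (∀ y : Site 2, (y, (1 : Fin 2)) ∈ Λ →
        H (y + Pi.single 0 1 + Pi.single 1 1) - H (y + Pi.single 0 1) =
            g (y, 1) (y + Pi.single 0 1, 0) ∧
        H (y + Pi.single 1 1) - H (y + Pi.single 0 1 + Pi.single 1 1) =
            g (y, 1) (y + Pi.single 1 1, 0) ∧
        H (y + Pi.single 0 1) - H (y + Pi.single 1 1) = g (y, 1) (y, 0)) := by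
  classical
  set e0 : Site 2 := Pi.single 0 1 with he0
  set e1 : Site 2 := Pi.single 1 1 with he1
  set R : Site 2 → Site 2 → Prop :=
    fun p q => ∃ f ∈ Λ.erase (x, 0), p ∈ hexFaceVertices f ∧ q ∈ hexFaceVertices f with hR
  have hRs : ∀ p q, R p q → R q p := fun p q ⟨f, hf, hp, hq⟩ => ⟨f, hf, hq, hp⟩
  -- adjacency and shared vertices of `(x, 0)` with its three neighbours
  have hadj0 : hexGraph.Adj (x, 0) (x - e1, 1) :=
    (hexGraph_adj_iff_of_snd_eq_zero_holds x _).2 (Or.inr (Or.inr rfl))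
  have hadj1 : hexGraph.Adj (x, 0) (x, 1) :=
    (hexGraph_adj_iff_of_snd_eq_zero_holds x _).2 (Or.inl rfl)
  have hadj2 : hexGraph.Adj (x, 0) (x - e0, 1) :=
    (hexGraph_adj_iff_of_snd_eq_zero_holds x _).2 (Or.inr (Or.inl rfl))
  have hne01 : ((x - e1, 1) : HexVertex) ≠ (x, 1) := by
    intro h; have := congrArg (fun f : HexVertex => f.1 1) h; simp [he1] at this
  have hne21 : ((x - e0, 1) : HexVertex) ≠ (x, 1) := by
    intro h; have := congrArg (fun f : HexVertex => f.1 0) h; simp [he0] at this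
  have mv : x ∈ hexFaceVertices (x, (0 : Fin 2)) ∧ x + e0 ∈ hexFaceVertices (x, (0 : Fin 2)) ∧
      x + e1 ∈ hexFaceVertices (x, (0 : Fin 2)) := by
    simp only [mem_hexFaceVertices_zero, he0, he1]; simp
  have m0 : x ∈ hexFaceVertices (x - e1, (1 : Fin 2)) ∧
      x + e0 ∈ hexFaceVertices (x - e1, (1 : Fin 2)) := by
    simp only [mem_hexFaceVertices_one, site_two_eq_iff, Pi.add_apply, Pi.sub_apply, he0, he1,
      Pi.single_apply]; simp
  have m1 : x + e0 ∈ hexFaceVertices (x, (1 : Fin 2)) ∧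
      x + e1 ∈ hexFaceVertices (x, (1 : Fin 2)) := by
    simp only [mem_hexFaceVertices_one, he0, he1]; simp
  have m2 : x + e1 ∈ hexFaceVertices (x - e0, (1 : Fin 2)) ∧
      x ∈ hexFaceVertices (x - e0, (1 : Fin 2)) := by
    simp only [mem_hexFaceVertices_one, site_two_eq_iff, Pi.add_apply, Pi.sub_apply, he0, he1,
      Pi.single_apply]; simp
  have hx0 : x ≠ x + e0 := by
    intro h; have := congrFun h 0; simp [he0] at this
  have hx1 : x ≠ x + e1 := by
    intro h; have := congrFun h 1; simp [he1] at this
  have h01 : x + e0 ≠ x + e1 := by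
    intro h; have := congrFun h 0; simp [he0, he1] at this
  -- the increments already present in `H'` across edges shared with faces of `Λ`
  have hd0 : ((x - e1, 1) : HexVertex) ∈ Λ → H' (x + e0) - H' x = g (x, 0) (x - e1, 1) := by
    intro hw
    have hw' : (x - e1, (1 : Fin 2)) ∈ Λ.erase (x, 0) :=
      Finset.mem_erase.2 ⟨fun h => absurd (congrArg Prod.snd h) (by simp), hw⟩
    have e := (hH'.2 (x - e1) hw').2.1
    have ha := hanti _ hv _ hw hadj0
    rw [show x - e1 + e1 = x from sub_add_cancel x e1,
      show x - e1 + e0 + e1 = x + e0 by abel] at e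
    linear_combination -e - ha
  have hd2 : ((x - e0, 1) : HexVertex) ∈ Λ → H' x - H' (x + e1) = g (x, 0) (x - e0, 1) := by
    intro hw
    have hw' : (x - e0, (1 : Fin 2)) ∈ Λ.erase (x, 0) :=
      Finset.mem_erase.2 ⟨fun h => absurd (congrArg Prod.snd h) (by simp), hw⟩
    have e := (hH'.2 (x - e0) hw').1
    have ha := hanti _ hv _ hw hadj2
    rw [show x - e0 + e0 = x from sub_add_cancel x e0] at e
    linear_combination -e - ha
  -- the three compatibilities
  have c01 : Relation.ReflTransGen R x (x + e0) → H' (x + e0) - H' x = g (x, 0) (x - e1, 1) := by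
    intro hr
    by_cases hw : ((x - e1, 1) : HexVertex) ∈ Λ
    · exact hd0 hw
    · exact absurd hr (not_reflTransGen_of_two_outer_nbrs hΛ hv hw hu hne01 hadj0 hadj1 mv.1 m0.1
        mv.2.1 m0.2 hx0)
  have c12 : Relation.ReflTransGen R (x + e0) (x + e1) →
      H' (x + e1) - H' (x + e0) = g (x, 0) (x, 1) := by
    intro hr
    by_cases hw : ((x - e1, 1) : HexVertex) ∈ Λ
    · by_cases hw' : ((x - e0, 1) : HexVertex) ∈ Λ
      · have := hcl0 x hv
        linear_combination -(hd0 hw) - (hd2 hw') - this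
      · exact absurd hr (not_reflTransGen_of_two_outer_nbrs hΛ hv hu hw' hne21.symm hadj1 hadj2
          mv.2.1 m1.1 mv.2.2 m1.2 h01)
    · exact absurd hr (not_reflTransGen_of_two_outer_nbrs hΛ hv hu hw hne01.symm hadj1 hadj0
        mv.2.1 m1.1 mv.2.2 m1.2 h01)
  have c20 : Relation.ReflTransGen R (x + e1) x → H' x - H' (x + e1) = g (x, 0) (x - e0, 1) := by
    intro hr
    by_cases hw : ((x - e0, 1) : HexVertex) ∈ Λ
    · exact hd2 hw
    · exact absurd hr (not_reflTransGen_of_two_outer_nbrs hΛ hv hw hu hne21 hadj2 hadj1 mv.2.2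
        m2.1 mv.1 m2.2 hx1.symm)
  obtain ⟨H, hHR, hH01, hH12, hH20⟩ :=
    extend_three R hRs H' x (x + e0) (x + e1) _ _ _ (hcl0 x hv) c01 c12 c20
  -- `H` is a potential on `Λ`
  have hold : ∀ f ∈ Λ.erase (x, 0), ∀ p q : Site 2, p ∈ hexFaceVertices f →
      q ∈ hexFaceVertices f → H q - H p = H' q - H' p :=
    fun f hf p q hp hq => hHR p q ⟨f, hf, hp, hq⟩
  refine ⟨H, fun y hy => ?_, fun y hy => ?_⟩
  · by_cases hyx : y = x
    · subst hyx; exact ⟨hH01, hH12, hH20⟩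
    · have hy' : (y, (0 : Fin 2)) ∈ Λ.erase (x, 0) :=
        Finset.mem_erase.2 ⟨fun h => hyx (congrArg Prod.fst h), hy⟩
      have my : y ∈ hexFaceVertices (y, (0 : Fin 2)) ∧
          y + e0 ∈ hexFaceVertices (y, (0 : Fin 2)) ∧
          y + e1 ∈ hexFaceVertices (y, (0 : Fin 2)) := by
        simp only [mem_hexFaceVertices_zero, he0, he1]; simp
      obtain ⟨a, b, c⟩ := hH'.1 y hy'
      exact ⟨by rw [hold _ hy' _ _ my.1 my.2.1, a], by rw [hold _ hy' _ _ my.2.1 my.2.2, b],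
        by rw [hold _ hy' _ _ my.2.2 my.1, c]⟩
  · have hy' : (y, (1 : Fin 2)) ∈ Λ.erase (x, 0) :=
      Finset.mem_erase.2 ⟨fun h => absurd (congrArg Prod.snd h) (by simp), hy⟩
    have my : y + e0 ∈ hexFaceVertices (y, (1 : Fin 2)) ∧
        y + e0 + e1 ∈ hexFaceVertices (y, (1 : Fin 2)) ∧
        y + e1 ∈ hexFaceVertices (y, (1 : Fin 2)) := by
      simp only [mem_hexFaceVertices_one, he0, he1, add_assoc]; simp
    obtain ⟨a, b, c⟩ := hH'.2 y hy'
    exact ⟨by rw [hold _ hy' _ _ my.1 my.2.1, a], by rw [hold _ hy' _ _ my.2.1 my.2.2, b],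
      by rw [hold _ hy' _ _ my.2.2 my.1, c]⟩

end Summit.CriticalPhenomena.SAWScalingLimit.Theorems.PotentialExists

end
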